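import Mathlib
import Literature.MathematicalPhysics.QuantumFieldTheory.Balaban1983to89.B1

/-!
# `Balaban1983to89.B1RG242` — the renormalization group equations (2.41)/(2.42) of B1, hence (2.43) = B4 (2.34), kernel-checked

B1 = T. Bałaban, *(Higgs)₂,₃ quantum fields in a finite volume. I. A lower bound*, Commun. Math. Phys. **85**,
603–636 (1982) [Balaban1982Higgs1] (journal page = PDF page + 602); B4 = T. Bałaban, *Regularity and decay of lattice
Green's functions*, Commun. Math. Phys. **89**, 571–597 (1983) [Balaban1983RegularityDecay] (journal page = PDF page
+ 570), whose reference [1] is B1; B5 = T. Bałaban, *Propagators and renormalization transformations for lattice gauge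
theories. I*, Commun. Math. Phys. **95**, 17–40 (1984) [Balaban1984PropagatorsI], whose reference [2] is B4.

CITATION HEADER (lean-in-tree rule 2026-08-18).  This module KERNEL-PROVES one printed passage for which no proof is
printed anywhere in the programme: B1 p. 612 [PDF 10], verbatim — *"Now we will find recursive relations between the
propagators (2.20), (2.30). Using the relations (2.18), (2.19), (2.21), we get after easy calculations
Z^ε_{k+1}(Ω,A) = Z^ε_k(Ω,A)Z^{(k),L^kε}(Ω,A), (2.39)  Z^ε_k(Ω,A) = Z^{(k−1),L^{k−1}ε}(Ω,A)·…·Z^{(1),Lε}(Ω,A)Z^{(0),ε}(Ω,A),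
(2.40)  Q_{k+1}(A)G^ε_{k+1}(Ω,A) = (aa_k/a_{k+1})(L^kε)^{−2}Q(A)C^{(k),L^kε}(Ω,A)Q_k(A)G^ε_k(Ω,A), (2.41)
G^ε_{k+1}(Ω,A) = a_k²(L^kε)^{−4}G^ε_k(Ω,A)Q^*_k(A)C^{(k),L^kε}(Ω,A)Q_k(A)G^ε_k(Ω,A) + G^ε_k(Ω,A). (2.42)  We can treat
these identities as recursive equations of the renormalization group. The last two are the most important. The
formula (2.41) allows us to compose the covariances appearing after the successive applications of renormalization
transformations. The formula (2.42) is used for similar purposes and it has a fundamental meaning for the analysis of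
the perturbation expansions, especially for the proof of its renormalizability. More exactly, an equality obtained by
solving (2.42), i.e. applying (2.42) k times, has such a meaning. Using the identity G^ε_1(Ω,A) = C^{(0),ε}(Ω,A), we
get  G^ε_k(Ω,A) = Σ_{j=1}^{k−1} a_j²(L^jε)^{−4}G^ε_j(Ω,A)Q^*_j(A)C^{(j),L^jε}(Ω,A)Q_j(A)G^ε_j(Ω,A) + C^{(0),ε}(Ω,A). (2.43)"*
— together with the operator content of the definitions it refers to (all B1, verbatim from the renders):
* p. 604 [PDF 2], (1.5): *"The adjoint operators with respect to the scalar product ⟨f,g⟩ = Σ_{x∈T_ε} ε^d f(x)·g(x)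
  (1.5) can be easily written up."*
* p. 608 [PDF 6], (2.6)–(2.7): *"t^{L^kε}_{a,L,A}(ψ(y), φ↾_{B(y)}) = (a(L^{k+1}ε)^{d−2}/2π)^{N/2} exp(−½a(L^{k+1}ε)^{d−2}
  |ψ(y) − (Q(A)φ)(y)|²), (2.6)  (Q(A)φ)(y) = L^{−d}Σ_{x∈B(y)} U(A(Γ_{y,x}))φ(x). (2.7)"*
* p. 609 [PDF 7], (2.10)–(2.14): *"… where Q_k(A) is an operator transforming functions on the ε-lattice T_ε into
  functions on the L^kε-lattice T^{(k)}_{L^kε} and given by the formula (Q_k(A)f)(y) = L^{−kd}Σ_{x∈B^k(y)}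
  U(A(Γ^{(k)}_{y,x}))f(x), y ∈ T^{(k)}_{L^kε}. (2.11) An easy Gaussian integration gives the formula … (2.12) where
  a, a_k, a_{k+1} satisfy the relation a_{k+1} = aa_k/(aL^{−2} + a_k). (2.13) From this formula we obtain
  T^{L^kε}_{a,L,A}T^ε_{a_k,L^k,A} = T^ε_{a_{k+1},L^{k+1},A}. (2.14)"*
* pp. 609–610 [PDF 7–8], (2.17)–(2.21): *"We define inductively Δ^{(0),ε}(Ω,A) = −Δ^{ε,N}_{A,Ω} + m², (2.17)
  Z^{(k),L^kε}(Ω,A) exp(−½⟨ψ,Δ^{(k+1),L^{k+1}ε}(Ω,A)ψ⟩) = T^{L^kε}_{a,L,A}[Ω^{(k)}, exp(−½⟨φ,Δ^{(k),L^kε}(Ω,A)φ⟩)]. (2.18)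
  From (2.16) we have Z^ε_k(Ω,A) exp(−½⟨ψ,Δ^{(k),L^kε}(Ω,A)ψ⟩) = T^ε_{a_k,L^k,A}[Ω, exp(−½⟨φ,(−Δ^{ε,N}_{A,Ω} + m²)φ⟩)].
  (2.19) Defining the propagator G^ε_k(Ω,A) = (−Δ^{ε,N}_{A,Ω} + m² + a_k(L^kε)^{−2}P_k(A))^{−1}, P_k(A) = Q^*_k(A)Q_k(A),
  (2.20) and calculating the integral in (2.19), we obtain ⟨ψ,Δ^{(k),L^kε}(Ω,A)ψ⟩ = a_k(L^kε)^{−2}⟨ψ,ψ⟩ −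
  a_k²(L^kε)^{−4}⟨ψ,Q_k(A)G^ε_k(Ω,A)Q^*_k(A)ψ⟩. (2.21)"*
* p. 611 [PDF 9], (2.30)–(2.31): *"We define a convariance [sic] C^{(k),L^kε}(Ω,A) by means of the quadratic form in
  φ in this integral: C^{(k),L^kε}(Ω,A) = (a(L^{k+1}ε)^{−2}P(A) + Δ^{(k),L^kε}(Ω,A))^{−1}. (2.30) In the sequel we
  will use the covariance rescaled to the unit lattice and it is of the form C^{(k)}(Ω,A) = (aL^{−2}P(A) +
  Δ^{(k)}(Ω,A))^{−1}. (2.31) It is not clear from the formulas (2.30), (2.31) that the covariances are well defined.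
  It is so, and it is one of the assertions of Proposition 2.3."*
Where (2.43) is CONSUMED downstream (verbatim): B4 p. 582 [PDF 12], in the proof of Lemma 2.2 (opened p. 581 [PDF 11]; the
reduction step immediately preceding the statement of Lemma 2.4) — *"This proof is based on
renormalization group equations (2.43) of [1] rescaled to the η-lattice: G_k(□) = C^{(0),η}(□) + Σ_{j=1}^{k−1}
a_j²(L^jη)^{−4}G^η_j(□)Q^*_jC^{(j),L^jη}(□)Q_jG^η_j(□). (2.34)"* (B4 p. 572 [PDF 2]: *"The projection operator P_k(A) is
given by P_k(A) = Q^*_k(A)Q_k(A). (1.5)"*, p. 580 [PDF 10]: *"The operator P_k is an orthogonal projection on a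
subspace of constant functions"*); B5 p. 39 [PDF 23], proof of Prop. 1.2 — *"We use Lemma 2.4 of that paper and the
equality (2.34) with □ replaced by the whole torus."* (typed in the tree as the named hypothesis
`B5Ineq137.Display136`, cell GAPS C-pv07-6 / G-pv07-2).

WHAT IS KERNEL-CHECKED HERE (finite-dimensional linear algebra over an arbitrary field 𝕜, resp. over ℝ for the
positivity part; every carrier an arbitrary `Fintype` — a torus, a parallelepiped □, or Ω = B^k(Ω^{(k)}) alike, so in
particular "(2.34) with □ replaced by the whole torus" is covered VERBATIM by the same theorem):
 §A  the abstract right-inverse identity behind (2.42) for RECTANGULAR block operators (`core_right_inverse`: if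
     A·G = 1, (Sm − c·V G U)·C = 1 and F·Sm = −c·1 then (A + U F V)(G + c·G U C V G) = 1 — no invertibility of F, U, V
     or c is used, unlike the textbook Woodbury formula), its companion for (2.41) (`core_241`), and the two scalar
     facts (γP − α)(βP + α) = −α² for a projection P when γ(α + β) = αβ (`coef_identity`), P² = P from QQ^* = 1
     (`proj_mul_proj`);
 §B  ONE renormalization step k → k + 1 as data `StepData` = (H := Δ^{(0),ε} = −Δ^{ε,N}_{A,Ω} + m² (2.17); Q_k, Q^*_k
     (2.11); Q, Q^* (2.7); α := a_k(L^kε)^{−2}; β := a(L^{k+1}ε)^{−2}) with the DEFINED objects P_k := Q^*_kQ_k, P := Q^*Q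
     (2.20)/(B4 (1.5)), G_k := (H + αP_k)^{−1} (2.20), Δ^{(k)} := α·1 − α²·Q_kG_kQ^*_k (2.21), C^{(k)} := (βP + Δ^{(k)})^{−1}
     (2.30), Q_{k+1} := QQ_k, Q^*_{k+1} := Q^*_kQ^*, γ := αβ/(α + β), G_{k+1} := (H + γQ^*_{k+1}Q_{k+1})^{−1}; and the
     theorems, under the hypotheses QQ^* = 1, α + β ≠ 0, H + αP_k invertible, βP + Δ^{(k)} invertible:
       (H + γP_{k+1})·(G_k + α²G_kQ^*_kC^{(k)}Q_kG_k) = 1                                   (`StepData.next_mul_eq_one`),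
       hence H + γP_{k+1} is invertible                                                    (`StepData.isUnit_next`),
       (2.42)  G_{k+1} = α²·G_kQ^*_kC^{(k)}Q_kG_k + G_k                                     (`StepData.display242`),
       (2.41)  Q_{k+1}G_{k+1} = (α + β)·QC^{(k)}Q_kG_k                                      (`StepData.display241`),
       and the consistency of (2.18) with (2.21) one level up: the Schur complement β·1 − β²·QC^{(k)}Q^* of the k-th
       step form equals γ·1 − γ²·Q_{k+1}G_{k+1}Q^*_{k+1}                                    (`StepData.display221_succ`);
 §C  over ℝ, with the scalar products (1.5) encoded by weight matrices W_ε, W_k, W_{k+1} (W_k, W_{k+1} positive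
     definite; W_ε enters only through the next two hypotheses), Q^*_k resp. Q^* the ADJOINTS of Q_k resp. Q for
     them, H positive semi-definite for W_ε, α, β > 0 (`StepData.ScalarProducts`): invertibility PROPAGATES DOWN
     the step — H + γP_{k+1} invertible ⟹ H + αP_k invertible (`isUnit_prev_of_next`) and ⟹ βP + Δ^{(k)}
     invertible (`isUnit_C_of_next`, the finite-lattice content of "It is so" for (2.30)); and H positive
     definite (m² > 0) ⟹ everything invertible
     (`isUnit_of_posDef`); packaged: (2.41)/(2.42) from the invertibility of G_{k+1}'s argument alone
     (`display242_of_next`, `display241_of_next`), resp. from m² > 0 alone (`display242_of_posDef`);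
 §D  the printed scalars: with α = a_k(L^kε)^{−2}, β = a(L^{k+1}ε)^{−2} and a_{k+1} = aa_k/(aL^{−2} + a_k) (2.13):
     γ = a_{k+1}(L^{k+1}ε)^{−2}, α + β = (aa_k/a_{k+1})(L^kε)^{−2}, α² = a_k²(L^kε)^{−4} (`scalars_213`), tied to the tree's
     `B1.aSeq`/`B1.aSeq_succ` (`StepData.γ_printed`, `display242_printed`, `display241_printed`) — so `display242` /
     `display241` ARE (2.42)/(2.41) with the printed coefficients and G_{k+1} = (H + a_{k+1}(L^{k+1}ε)^{−2}P_{k+1})^{−1}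
     as in (2.20);
 §E  the tower: levels j ≥ 1 of `StepData` sharing H, with Q_{j+1} = Q^{(j)}Q_j, Q^*_{j+1} = Q^*_jQ^{(j)*},
     α_{j+1} = α_jβ_j/(α_j + β_j) (`Tower`, `Tower.Consistent`) ⟹ (2.43) = B4 (2.34):
       G_k = Σ_{j=1}^{k−1} α_j²·G_jQ^*_jC^{(j)}Q_jG_j + G_1,  k ≥ 1                            (`Tower.display243`)
     by the tree's telescoping lemma `B1.display243_of_242` (R := Matrix ι ι 𝕜), where G_1 = (H + α_1P_1)^{−1} =
     (a(Lε)^{−2}P(A) + Δ^{(0),ε})^{−1} = C^{(0),ε} is (2.30) at k = 0 read with (2.17) — the printed "identity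
     G^ε_1(Ω,A) = C^{(0),ε}(Ω,A)" is definitional in this typing (a_1 = a: B1 p. 609 "an initial condition a_1 = a";
     Q_1(A) = Q(A): (2.11) at k = 1 is (2.7) at k = 0; P_1 = P: (2.20) vs. B4 (1.5)); over ℝ the two
     invertibility fields of `Tower.Consistent` follow from the structural ones + the scalar products (1.5) at every
     level + m² > 0 (`Tower.consistent_of_posDef`, `Tower.display243_of_posDef`).
DICTIONARY (print ↦ Lean): −Δ^{ε,N}_{A,Ω} + m² ↦ `S.H`; Q_k(A), Q^*_k(A) ↦ `S.Qk`, `S.Qks`; Q(A), Q^*(A) (on the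
L^kε-lattice) ↦ `S.Q`, `S.Qs`; a_k(L^kε)^{−2} ↦ `S.α`; a(L^{k+1}ε)^{−2} ↦ `S.β`; a_{k+1}(L^{k+1}ε)^{−2} ↦ `S.γ` (§D);
P_k(A) ↦ `S.Pk`; P(A) ↦ `S.P`; G^ε_k(Ω,A) ↦ `S.Gk`; Δ^{(k),L^kε}(Ω,A) ↦ `S.Δk`; C^{(k),L^kε}(Ω,A) ↦ `S.Ck`; Q_{k+1}(A) ↦
`S.Qk1`; P_{k+1}(A) ↦ `S.Pk1`; G^ε_{k+1}(Ω,A) ↦ `S.Gk1`; ⟨·,·⟩ of (1.5) on T_ε, T^{(k)}_{L^kε}, T^{(k+1)}_{L^{k+1}ε} ↦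
`u ⬝ᵥ (WE *ᵥ v)`, `u ⬝ᵥ (WK *ᵥ v)`, `u ⬝ᵥ (WM *ᵥ v)` (§C).  Operators are matrices acting by `*ᵥ`; "invertible" is
`IsUnit`, and `M⁻¹` is Mathlib's `Matrix.inv` (which agrees with the inverse exactly when `IsUnit M`, the only case
in which it is used in a conclusion here).

WHAT IS NOT CERTIFIED HERE, AND HOW IT IS LABELLED.  (i) The Gaussian-integral ↦ Schur-complement dictionary that
turns (2.18)/(2.19) into the operator definitions of §B ("calculating the integral in (2.19), we obtain (2.21)"; the
quadratic form of the k-th step integrand in (φ, ψ) is [[βP + Δ^{(k)}, −βQ^*], [−βQ, β·1]] by (2.6) with (2.15)) —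
[folklore: finite-dimensional Gaussian integration]; it is the REASON the defined objects are Bałaban's, and it is
not re-derived from measure theory here.  (ii) The determinant identities (2.39)/(2.40) (normalisation factors) —
not typed.  (iii) QQ^* = 1, Q_kQ^*_k = 1 (block averages of an isometric parallel transport are co-isometries for the
scalar products (1.5); B4 p. 580: "P_k is an orthogonal projection") and the composition rule Q_{k+1}(A) = Q(A)Q_k(A)
(concatenation of the contours (2.2), the operator content of (2.12)/(2.14)) — HYPOTHESES (`hQ`,
`Tower.Consistent`), never asserted for Bałaban's concrete operators, which are not constructed in this module.
(iv) The QUANTITATIVE assertions of B1 Prop. 2.3 / (2.33) (γ₀I ≤ aL^{−2}P + Δ^{(k)} ≤ γ₁I uniformly in k) and all of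
B4 Lemma 2.4 (2.35)–(2.37) — untouched; §C gives only the qualitative finite-lattice invertibility.  (v) The abelian
setting of B1 (U(1)-valued U(A(Γ))) versus the non-abelian one of B4/B5: irrelevant here, since Q_k, Q^*_k, Q, Q^* are
DATA and only QQ^* = 1 and adjointness are used.
CELL BOOK-KEEPING (pub-balaban).  Discharges, at operator level and for every finite carrier, GAPS G-B4-06 (b) (B4's
use of "(2.43) of [1]": B1 prints no proof — "after easy calculations") and G-pv07-2 (a) ("(2.34) with □ replaced by
the whole torus": the identity is carrier-independent); it does NOT discharge `B5Ineq137.Display136` (which is (2.34)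
on the torus with each term rescaled to its unit lattice and read on kernels — the rescaling/kernel dictionary is a
separate, model-level step, C-pv07-6), nor anything quantitative.  Typing decisions are recorded as cell DIVERGENCE
D-pv07.12 (QQ^* = 1 and adjointness as hypotheses; γ := αβ/(α + β) proved equal to the printed a_{k+1}(L^{k+1}ε)^{−2};
Mathlib's `Matrix.add_mul_mul_inv_eq_sub` (Woodbury) deliberately not used: it would demand the invertibility of the
middle factor γP − α·1, i.e. α ≠ 0, and an inverse-of-inverse bookkeeping foreign to the print, whereas the direct
right-inverse computation of §A needs neither).
VALUE = kernel certificate for a located gap ("easy calculations" nowhere printed), NOT summit progress.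
-/

namespace Literature.MathematicalPhysics.QuantumFieldTheory.Balaban1983to89.B1RG242

open Matrix

/-! ## §A  The abstract identities (rectangular block operators over a field) -/

section Core

variable {𝕜 : Type*} [Field 𝕜]
variable {ι κ ν : Type*}

/-- P := Q^*Q is idempotent as soon as QQ^* = 1 (B4 p. 580: "The operator P_k is an orthogonal projection").
[folklore] -/
theorem proj_mul_proj [Fintype κ] [Fintype ν] [DecidableEq ν] (Q : Matrix ν κ 𝕜) (Qs : Matrix κ ν 𝕜)
    (hQ : Q * Qs = 1) : Qs * Q * (Qs * Q) = Qs * Q := by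
  rw [Matrix.mul_assoc, ← Matrix.mul_assoc Q, hQ, Matrix.one_mul]

/-- The scalar heart of (2.42): for an idempotent P and γ(α + β) = αβ (i.e. γ = a_{k+1}(L^{k+1}ε)^{−2} by (2.13),
§D), (γP − α·1)(βP + α·1) = −α²·1. [folklore] -/
theorem coef_identity [Fintype κ] [DecidableEq κ] (P : Matrix κ κ 𝕜) (hP : P * P = P) {α β γ : 𝕜}
    (hγ : γ * (α + β) = α * β) :
    (γ • P - α • (1 : Matrix κ κ 𝕜)) * (β • P + α • (1 : Matrix κ κ 𝕜)) = -(α ^ 2 • (1 : Matrix κ κ 𝕜)) := by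
  simp only [Matrix.sub_mul, Matrix.mul_add, Matrix.smul_mul, Matrix.mul_smul, Matrix.mul_one,
    Matrix.one_mul, hP]
  match_scalars <;> first | linear_combination hγ | ring

/-- The right-inverse identity behind (2.42), for RECTANGULAR U : ι × κ, V : κ × ι: if A·G = 1, (Sm − c·VGU)·C = 1
and F·Sm = −c·1, then (A + UFV)·(G + c·GUCVG) = 1.  No invertibility of F, U, V, c is assumed (contrast: the
Woodbury formula `Matrix.add_mul_mul_inv_eq_sub`). [folklore] -/
theorem core_right_inverse [Fintype ι] [Fintype κ] [DecidableEq ι] [DecidableEq κ] (A Gk : Matrix ι ι 𝕜)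
    (U : Matrix ι κ 𝕜) (V : Matrix κ ι 𝕜) (F Sm Ck : Matrix κ κ 𝕜) (c : 𝕜) (hG : A * Gk = 1)
    (hC : (Sm - c • (V * Gk * U)) * Ck = 1) (hFS : F * Sm = -(c • (1 : Matrix κ κ 𝕜))) :
    (A + U * F * V) * (Gk + c • (Gk * U * Ck * V * Gk)) = 1 := by
  have hGX : ∀ X : Matrix ι ι 𝕜, A * (Gk * X) = X := fun X => by
    rw [← Matrix.mul_assoc, hG, Matrix.one_mul]
  have hCX : ∀ W : Matrix κ ι 𝕜, c • (V * (Gk * (U * (Ck * W)))) = Sm * (Ck * W) - W := by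
    intro W
    have h := congrArg (· * W) hC
    simp only [Matrix.sub_mul, Matrix.smul_mul, Matrix.one_mul, Matrix.mul_assoc] at h
    calc c • (V * (Gk * (U * (Ck * W))))
        = Sm * (Ck * W) - (Sm * (Ck * W) - c • (V * (Gk * (U * (Ck * W))))) := by abel
      _ = Sm * (Ck * W) - W := by rw [h]
  have hCX' : ∀ W : Matrix κ ι 𝕜,
      c • (U * (F * (V * (Gk * (U * (Ck * W)))))) = U * (F * (Sm * (Ck * W))) - U * (F * W) := by
    intro W
    rw [← Matrix.mul_sub, ← Matrix.mul_sub, ← hCX W, Matrix.mul_smul, Matrix.mul_smul]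
  have hFX : ∀ Z : Matrix κ ι 𝕜, F * (Sm * Z) = -(c • Z) := fun Z => by
    rw [← Matrix.mul_assoc, hFS, Matrix.neg_mul, Matrix.smul_mul, Matrix.one_mul]
  simp only [Matrix.add_mul, Matrix.mul_add, Matrix.mul_smul, smul_add, Matrix.mul_assoc, hG, hGX]
  rw [hCX' (V * Gk), hFX, Matrix.mul_neg, Matrix.mul_smul]
  abel

/-- The companion identity behind (2.41): if (Sm − c·VGU)·C = 1 and Q·Sm = s·Q then
QV·(G + c·GUCVG) = s·QCVG. [folklore] -/
theorem core_241 [Fintype ι] [Fintype κ] [DecidableEq κ] (Gk : Matrix ι ι 𝕜) (U : Matrix ι κ 𝕜)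
    (V : Matrix κ ι 𝕜) (Q : Matrix ν κ 𝕜) (Sm Ck : Matrix κ κ 𝕜) (c s : 𝕜)
    (hC : (Sm - c • (V * Gk * U)) * Ck = 1) (hQS : Q * Sm = s • Q) :
    Q * V * (Gk + c • (Gk * U * Ck * V * Gk)) = s • (Q * Ck * V * Gk) := by
  have hCX : ∀ W : Matrix κ ι 𝕜, c • (V * (Gk * (U * (Ck * W)))) = Sm * (Ck * W) - W := by
    intro W
    have h := congrArg (· * W) hC
    simp only [Matrix.sub_mul, Matrix.smul_mul, Matrix.one_mul, Matrix.mul_assoc] at h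
    calc c • (V * (Gk * (U * (Ck * W))))
        = Sm * (Ck * W) - (Sm * (Ck * W) - c • (V * (Gk * (U * (Ck * W))))) := by abel
      _ = Sm * (Ck * W) - W := by rw [h]
  have hQX : ∀ Z : Matrix κ ι 𝕜, Q * (Sm * Z) = s • (Q * Z) := fun Z => by
    rw [← Matrix.mul_assoc, hQS, Matrix.smul_mul]
  simp only [Matrix.mul_add, Matrix.mul_smul, Matrix.mul_assoc]
  rw [← Matrix.mul_smul, hCX (V * Gk), Matrix.mul_sub, hQX]
  abel

/-- Injectivity of `M *ᵥ ·` from triviality of its kernel (M square over a ring). [folklore] -/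
theorem mulVec_injective_of_ker {R : Type*} [Ring R] [Fintype κ] {M : Matrix κ κ R}
    (h : ∀ v, M *ᵥ v = 0 → v = 0) : Function.Injective M.mulVec := by
  intro x y hxy
  have h0 : M *ᵥ (x - y) = 0 := by rw [Matrix.mulVec_sub, hxy, sub_self]
  exact sub_eq_zero.mp (h _ h0)

end Core

/-! ## §B  One renormalization step k → k + 1 (B1 (2.17), (2.20), (2.21), (2.30) ⟹ (2.41), (2.42)) -/

/-- The DATA of one renormalization step, B1 §2 (all operators as matrices over finite index types: `ι` = the sites
of Ω ⊂ T_ε (times the internal index), `κ` = the sites of Ω^{(k)} ⊂ T^{(k)}_{L^kε}, `ν` = those of Ω^{(k+1)}):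
`H` ↤ Δ^{(0),ε}(Ω,A) = −Δ^{ε,N}_{A,Ω} + m² (2.17); `Qk`, `Qks` ↤ Q_k(A), Q^*_k(A) (2.11), (1.5); `Q`, `Qs` ↤ Q(A), Q^*(A)
on the L^kε-lattice (2.7); `α` ↤ a_k(L^kε)^{−2}; `β` ↤ a(L^{k+1}ε)^{−2} ((2.20), (2.30)).  Nothing is assumed of the data
here; the hypotheses (QQ^* = 1, invertibility, adjointness) are carried by the theorems.
[cite: Balaban1982Higgs1, (2.7) p.608, (2.11) p.609, (2.17)/(2.20) p.610, (2.30) p.611] -/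
structure StepData (𝕜 : Type*) (ι κ ν : Type*) where
  /-- Δ^{(0),ε}(Ω,A) = −Δ^{ε,N}_{A,Ω} + m² (2.17). -/
  H : Matrix ι ι 𝕜
  /-- Q_k(A) (2.11): functions on the ε-lattice ↦ functions on the L^kε-lattice. -/
  Qk : Matrix κ ι 𝕜
  /-- Q^*_k(A), the (1.5)-adjoint of Q_k(A). -/
  Qks : Matrix ι κ 𝕜
  /-- Q(A) (2.7) on the L^kε-lattice: functions on T^{(k)}_{L^kε} ↦ functions on T^{(k+1)}_{L^{k+1}ε}. -/
  Q : Matrix ν κ 𝕜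
  /-- Q^*(A), the (1.5)-adjoint of Q(A). -/
  Qs : Matrix κ ν 𝕜
  /-- α = a_k(L^kε)^{−2}, the coefficient of P_k(A) in (2.20). -/
  α : 𝕜
  /-- β = a(L^{k+1}ε)^{−2}, the coefficient of P(A) in (2.30). -/
  β : 𝕜

namespace StepData

variable {𝕜 : Type*} [Field 𝕜] {ι κ ν : Type*}
variable [Fintype ι] [Fintype κ] [Fintype ν] [DecidableEq ι] [DecidableEq κ] [DecidableEq ν]
variable (S : StepData 𝕜 ι κ ν)

/-- P_k(A) = Q^*_k(A)Q_k(A) (2.20) (= B4 (1.5)). [cite: Balaban1982Higgs1, (2.20) p.610] -/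
def Pk : Matrix ι ι 𝕜 := S.Qks * S.Qk

/-- P(A) = Q^*(A)Q(A) on the L^kε-lattice ((2.30); B4 (1.5) at k = 1). [cite: Balaban1982Higgs1, (2.30) p.611] -/
def P : Matrix κ κ 𝕜 := S.Qs * S.Q

/-- G^ε_k(Ω,A) = (−Δ^{ε,N}_{A,Ω} + m² + a_k(L^kε)^{−2}P_k(A))^{−1} (2.20) (Mathlib `Matrix.inv`; it is the inverse under
the hypothesis `IsUnit (S.H + S.α • S.Pk)` carried by the theorems). [cite: Balaban1982Higgs1, (2.20) p.610] -/
noncomputable def Gk : Matrix ι ι 𝕜 := (S.H + S.α • S.Pk)⁻¹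

/-- Δ^{(k),L^kε}(Ω,A) as the operator of the form (2.21): ⟨ψ,Δ^{(k)}ψ⟩ = a_k(L^kε)^{−2}⟨ψ,ψ⟩ −
a_k²(L^kε)^{−4}⟨ψ,Q_kG^ε_kQ^*_kψ⟩. [cite: Balaban1982Higgs1, (2.21) p.610] -/
noncomputable def Δk : Matrix κ κ 𝕜 := S.α • (1 : Matrix κ κ 𝕜) - S.α ^ 2 • (S.Qk * S.Gk * S.Qks)

/-- C^{(k),L^kε}(Ω,A) = (a(L^{k+1}ε)^{−2}P(A) + Δ^{(k),L^kε}(Ω,A))^{−1} (2.30). [cite: Balaban1982Higgs1, (2.30) p.611] -/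
noncomputable def Ck : Matrix κ κ 𝕜 := (S.β • S.P + S.Δk)⁻¹

/-- γ := αβ/(α + β); by (2.13) this is a_{k+1}(L^{k+1}ε)^{−2}, the coefficient of P_{k+1} in G^ε_{k+1} (2.20) — see
`γ_printed` (§D). [cite: Balaban1982Higgs1, (2.13) p.609] -/
noncomputable def γ : 𝕜 := S.α * S.β / (S.α + S.β)

/-- Q_{k+1}(A) = Q(A)Q_k(A) (composition of block averages along the concatenated contours (2.2); the operator content
of (2.12)/(2.14)). [cite: Balaban1982Higgs1, (2.2) p.608, (2.11)–(2.14) p.609] -/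
def Qk1 : Matrix ν ι 𝕜 := S.Q * S.Qk

/-- Q^*_{k+1}(A) = Q^*_k(A)Q^*(A). [cite: Balaban1982Higgs1, (1.5) p.604, (2.11) p.609] -/
def Qk1s : Matrix ι ν 𝕜 := S.Qks * S.Qs

/-- P_{k+1}(A) = Q^*_{k+1}(A)Q_{k+1}(A) ((2.20) at k + 1). [cite: Balaban1982Higgs1, (2.20) p.610] -/
def Pk1 : Matrix ι ι 𝕜 := S.Qk1s * S.Qk1

/-- G^ε_{k+1}(Ω,A) = (−Δ^{ε,N}_{A,Ω} + m² + a_{k+1}(L^{k+1}ε)^{−2}P_{k+1}(A))^{−1} ((2.20) at k + 1, with `S.γ` for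
a_{k+1}(L^{k+1}ε)^{−2}, §D). [cite: Balaban1982Higgs1, (2.20) p.610] -/
noncomputable def Gk1 : Matrix ι ι 𝕜 := (S.H + S.γ • S.Pk1)⁻¹

omit [Fintype ι] [DecidableEq ι] [DecidableEq κ] in
/-- P(A)² = P(A) from QQ^* = 1 (B4 p. 580: "an orthogonal projection"). [folklore] -/
theorem P_mul_P (hQ : S.Q * S.Qs = 1) : S.P * S.P = S.P := proj_mul_proj S.Q S.Qs hQ

omit [Fintype ι] [Fintype κ] [Fintype ν] [DecidableEq ι] [DecidableEq κ] [DecidableEq ν] in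
/-- γ(α + β) = αβ, i.e. (2.13) cleared of denominators (§D). [cite: Balaban1982Higgs1, (2.13) p.609] -/
theorem γ_mul (hαβ : S.α + S.β ≠ 0) : S.γ * (S.α + S.β) = S.α * S.β := div_mul_cancel₀ _ hαβ

omit [Fintype ν] [DecidableEq κ] [DecidableEq ν] in
/-- G^ε_k is the (right) inverse of its argument when the latter is invertible. [folklore] -/
theorem Gk_mul (hG : IsUnit (S.H + S.α • S.Pk)) : (S.H + S.α • S.Pk) * S.Gk = 1 :=
  Matrix.mul_nonsing_inv _ ((Matrix.isUnit_iff_isUnit_det _).mp hG)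

omit [Fintype ν] [DecidableEq κ] [DecidableEq ν] in
/-- G^ε_k is also the left inverse of its argument (finite matrices). [folklore] -/
theorem mul_Gk (hG : IsUnit (S.H + S.α • S.Pk)) : S.Gk * (S.H + S.α • S.Pk) = 1 :=
  Matrix.nonsing_inv_mul _ ((Matrix.isUnit_iff_isUnit_det _).mp hG)

omit [DecidableEq ν] in
/-- C^{(k),L^kε} is the (right) inverse of its argument when the latter is invertible ("It is so", finite lattice).
[folklore] -/
theorem Ck_mul (hC : IsUnit (S.β • S.P + S.Δk)) : (S.β • S.P + S.Δk) * S.Ck = 1 :=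
  Matrix.mul_nonsing_inv _ ((Matrix.isUnit_iff_isUnit_det _).mp hC)

omit [DecidableEq ν] in
/-- C^{(k),L^kε} is also the left inverse of its argument (finite matrices). [folklore] -/
theorem mul_Ck (hC : IsUnit (S.β • S.P + S.Δk)) : S.Ck * (S.β • S.P + S.Δk) = 1 :=
  Matrix.nonsing_inv_mul _ ((Matrix.isUnit_iff_isUnit_det _).mp hC)

omit [Fintype ι] [DecidableEq ι] [DecidableEq ν] in
/-- H + γP_{k+1} = (H + αP_k) + Q^*_k(γP − α·1)Q_k — the block form to which `core_right_inverse` applies. [folklore] -/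
theorem next_arg_eq :
    S.H + S.γ • S.Pk1 = (S.H + S.α • S.Pk) + S.Qks * (S.γ • S.P - S.α • (1 : Matrix κ κ 𝕜)) * S.Qk := by
  simp only [Pk1, Qk1, Qk1s, Pk, P, Matrix.mul_sub, Matrix.sub_mul, Matrix.mul_smul, Matrix.smul_mul,
    Matrix.mul_one, Matrix.mul_assoc]
  abel

omit [DecidableEq ν] in
/-- βP + Δ^{(k)} = (βP + α·1) − α²·Q_kG_kQ^*_k ((2.21) inserted in (2.30)). [cite: Balaban1982Higgs1, (2.21) p.610, (2.30) p.611] -/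
theorem C_arg_eq : S.β • S.P + S.Δk = (S.β • S.P + S.α • (1 : Matrix κ κ 𝕜)) - S.α ^ 2 • (S.Qk * S.Gk * S.Qks) := by
  simp only [Δk]
  abel

omit [Fintype ι] [DecidableEq ι] in
/-- Q(βP + α·1) = (α + β)Q, from QQ^* = 1. [folklore] -/
theorem Q_mul_Sm (hQ : S.Q * S.Qs = 1) :
    S.Q * (S.β • S.P + S.α • (1 : Matrix κ κ 𝕜)) = (S.α + S.β) • S.Q := by
  rw [Matrix.mul_add, Matrix.mul_smul, Matrix.mul_smul, Matrix.mul_one, P, ← Matrix.mul_assoc, hQ,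
    Matrix.one_mul, add_smul, add_comm]

omit [Fintype ι] [DecidableEq ι] in
/-- (βP + α·1)Q^* = (α + β)Q^*, from QQ^* = 1. [folklore] -/
theorem Sm_mul_Qs (hQ : S.Q * S.Qs = 1) :
    (S.β • S.P + S.α • (1 : Matrix κ κ 𝕜)) * S.Qs = (S.α + S.β) • S.Qs := by
  rw [Matrix.add_mul, Matrix.smul_mul, Matrix.smul_mul, Matrix.one_mul, P, Matrix.mul_assoc, hQ,
    Matrix.mul_one, add_smul, add_comm]

/-- THE COMPUTATION behind (2.42) ("after easy calculations", B1 p. 612 — no proof printed):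
(H + γP_{k+1})·(G_k + α²·G_kQ^*_kC^{(k)}Q_kG_k) = 1, under QQ^* = 1, α + β ≠ 0 and the invertibility of the arguments
of G_k (2.20) and C^{(k)} (2.30). [cite: Balaban1982Higgs1, (2.42) p.612] -/
theorem next_mul_eq_one (hQ : S.Q * S.Qs = 1) (hαβ : S.α + S.β ≠ 0) (hG : IsUnit (S.H + S.α • S.Pk))
    (hC : IsUnit (S.β • S.P + S.Δk)) :
    (S.H + S.γ • S.Pk1) * (S.Gk + S.α ^ 2 • (S.Gk * S.Qks * S.Ck * S.Qk * S.Gk)) = 1 := by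
  have hC' : (S.β • S.P + S.α • (1 : Matrix κ κ 𝕜) - S.α ^ 2 • (S.Qk * S.Gk * S.Qks)) * S.Ck = 1 := by
    rw [← C_arg_eq]; exact S.Ck_mul hC
  rw [next_arg_eq]
  exact core_right_inverse (S.H + S.α • S.Pk) S.Gk S.Qks S.Qk (S.γ • S.P - S.α • 1) (S.β • S.P + S.α • 1) S.Ck
    (S.α ^ 2) (S.Gk_mul hG) hC' (coef_identity S.P (S.P_mul_P hQ) (S.γ_mul hαβ))

/-- Hence −Δ^{ε,N}_{A,Ω} + m² + a_{k+1}(L^{k+1}ε)^{−2}P_{k+1}(A) is invertible: G^ε_{k+1} (2.20) is well defined as soon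
as G^ε_k and C^{(k),L^kε} are. [cite: Balaban1982Higgs1, (2.20) p.610, (2.42) p.612] -/
theorem isUnit_next (hQ : S.Q * S.Qs = 1) (hαβ : S.α + S.β ≠ 0) (hG : IsUnit (S.H + S.α • S.Pk))
    (hC : IsUnit (S.β • S.P + S.Δk)) : IsUnit (S.H + S.γ • S.Pk1) :=
  (Matrix.isUnit_iff_isUnit_det _).mpr (Matrix.isUnit_det_of_right_inverse (S.next_mul_eq_one hQ hαβ hG hC))

/-- B1 (2.42), KERNEL-PROVED: G^ε_{k+1}(Ω,A) = a_k²(L^kε)^{−4}G^ε_kQ^*_kC^{(k),L^kε}Q_kG^ε_k + G^ε_k (α² = a_k²(L^kε)^{−4},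
`display242_printed`), on any finite carrier, under QQ^* = 1, α + β ≠ 0 and the invertibility of the arguments of
(2.20) and (2.30). [cite: Balaban1982Higgs1, (2.42) p.612] -/
theorem display242 (hQ : S.Q * S.Qs = 1) (hαβ : S.α + S.β ≠ 0) (hG : IsUnit (S.H + S.α • S.Pk))
    (hC : IsUnit (S.β • S.P + S.Δk)) :
    S.Gk1 = S.α ^ 2 • (S.Gk * S.Qks * S.Ck * S.Qk * S.Gk) + S.Gk := by
  rw [Gk1, Matrix.inv_eq_right_inv (S.next_mul_eq_one hQ hαβ hG hC), add_comm]

/-- B1 (2.41), KERNEL-PROVED: Q_{k+1}(A)G^ε_{k+1}(Ω,A) = (aa_k/a_{k+1})(L^kε)^{−2}Q(A)C^{(k),L^kε}Q_k(A)G^ε_k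
(α + β = (aa_k/a_{k+1})(L^kε)^{−2}, `display241_printed`), same hypotheses. [cite: Balaban1982Higgs1, (2.41) p.612] -/
theorem display241 (hQ : S.Q * S.Qs = 1) (hαβ : S.α + S.β ≠ 0) (hG : IsUnit (S.H + S.α • S.Pk))
    (hC : IsUnit (S.β • S.P + S.Δk)) :
    S.Qk1 * S.Gk1 = (S.α + S.β) • (S.Q * S.Ck * S.Qk * S.Gk) := by
  have hC' : (S.β • S.P + S.α • (1 : Matrix κ κ 𝕜) - S.α ^ 2 • (S.Qk * S.Gk * S.Qks)) * S.Ck = 1 := by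
    rw [← C_arg_eq]; exact S.Ck_mul hC
  rw [S.display242 hQ hαβ hG hC, add_comm, Qk1]
  exact core_241 S.Gk S.Qks S.Qk S.Q (S.β • S.P + S.α • 1) S.Ck (S.α ^ 2) (S.α + S.β) hC' (S.Q_mul_Sm hQ)

/-- Consistency of the inductive definition (2.18) with the closed form (2.21) one level up, KERNEL-PROVED: the
Schur complement (in ψ) of the k-th step form [[βP + Δ^{(k)}, −βQ^*], [−βQ, β·1]] — which is what (2.18) defines as
Δ^{(k+1),L^{k+1}ε} [folklore: Gaussian integration] — equals the (2.21)-expression at k + 1: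
β·1 − β²·QC^{(k)}Q^* = γ·1 − γ²·Q_{k+1}G^ε_{k+1}Q^*_{k+1}. [cite: Balaban1982Higgs1, (2.18)/(2.21) p.610, (2.41) p.612] -/
theorem display221_succ (hQ : S.Q * S.Qs = 1) (hαβ : S.α + S.β ≠ 0) (hG : IsUnit (S.H + S.α • S.Pk))
    (hC : IsUnit (S.β • S.P + S.Δk)) :
    S.β • (1 : Matrix ν ν 𝕜) - S.β ^ 2 • (S.Q * S.Ck * S.Qs)
      = S.γ • (1 : Matrix ν ν 𝕜) - S.γ ^ 2 • (S.Qk1 * S.Gk1 * S.Qk1s) := by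
  have h241 := S.display241 hQ hαβ hG hC
  have hCD : S.Ck * (S.β • S.P + S.Δk) = 1 := S.mul_Ck hC
  have hSQ := S.Sm_mul_Qs hQ
  have hγ := S.γ_mul hαβ
  -- step 1: QC^{(k)}(α²Q_kG_kQ^*_k)Q^* = (α+β)·QC^{(k)}Q^* − 1, from α²Q_kG_kQ^*_k = (βP + α) − (βP + Δ^{(k)})
  have hZ : S.α ^ 2 • (S.Qk * S.Gk * S.Qks) = (S.β • S.P + S.α • 1) - (S.β • S.P + S.Δk) := by
    rw [S.C_arg_eq]; abel
  have step1 : S.Q * S.Ck * (S.α ^ 2 • (S.Qk * S.Gk * S.Qks)) * S.Qs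
      = (S.α + S.β) • (S.Q * S.Ck * S.Qs) - 1 := by
    rw [hZ, Matrix.mul_sub, Matrix.sub_mul, Matrix.mul_assoc (S.Q * S.Ck), hSQ, Matrix.mul_smul,
      Matrix.mul_assoc S.Q S.Ck (S.β • S.P + S.Δk), hCD, Matrix.mul_one, hQ]
  -- step 2: Q_{k+1}G_{k+1}Q^*_{k+1} = (α+β)·QC^{(k)}(Q_kG_kQ^*_k)Q^*  by (2.41)
  have step2 : S.Qk1 * S.Gk1 * S.Qk1s = (S.α + S.β) • (S.Q * S.Ck * (S.Qk * S.Gk * S.Qks) * S.Qs) := by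
    rw [h241, Qk1s, Matrix.smul_mul]
    simp only [Matrix.mul_assoc]
  -- step 3: (α+β)γ²·Q_{k+1}G_{k+1}Q^*_{k+1} = (α+β)β²·QC^{(k)}Q^* − β²·1
  have step3 : ((S.α + S.β) * S.γ ^ 2) • (S.Qk1 * S.Gk1 * S.Qk1s)
      = ((S.α + S.β) * S.β ^ 2) • (S.Q * S.Ck * S.Qs) - S.β ^ 2 • (1 : Matrix ν ν 𝕜) := by
    rw [step2, smul_smul]
    have hs : (S.α + S.β) * S.γ ^ 2 * (S.α + S.β) = S.β ^ 2 * S.α ^ 2 := by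
      linear_combination (S.γ * (S.α + S.β) + S.α * S.β) * hγ
    have e : (S.β ^ 2 * S.α ^ 2) • (S.Q * S.Ck * (S.Qk * S.Gk * S.Qks) * S.Qs)
        = S.β ^ 2 • (S.Q * S.Ck * (S.α ^ 2 • (S.Qk * S.Gk * S.Qks)) * S.Qs) := by
      simp only [Matrix.mul_smul, Matrix.smul_mul, smul_smul, Matrix.mul_assoc]
    rw [hs, e, step1, smul_sub, smul_smul, mul_comm (S.β ^ 2) (S.α + S.β)]
  -- step 4: cancel the invertible scalar α + β
  refine smul_right_injective (Matrix ν ν 𝕜) hαβ ?_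
  show (S.α + S.β) • _ = (S.α + S.β) • _
  simp only [smul_sub, smul_smul]
  rw [step3, show (S.α + S.β) * S.γ = S.α * S.β by rw [mul_comm]; exact hγ,
    show (S.α + S.β) * S.β = S.α * S.β + S.β ^ 2 by ring, add_smul]
  abel

end StepData

/-! ## §C  Invertibility on a finite lattice from positivity (the qualitative "It is so" of B1 p. 611), over ℝ -/

section Positivity

variable {ι κ ν : Type*} [Fintype ι] [Fintype κ] [Fintype ν] [DecidableEq ι] [DecidableEq κ] [DecidableEq ν]

omit [Fintype ν] [DecidableEq ι] [DecidableEq κ] [DecidableEq ν] in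
/-- The kernel of H + c·X^*X (c > 0) lies in ker H ∩ ker X, when H is positive semi-definite and X^* is the adjoint of X
for positive definite scalar products encoded by the weights W_E, W_K. [folklore] -/
theorem ker_add_smul_adj {H : Matrix ι ι ℝ} {X : Matrix κ ι ℝ} {Xs : Matrix ι κ ℝ} {WE : Matrix ι ι ℝ}
    {WK : Matrix κ κ ℝ} {c : ℝ} (hc : 0 < c) (hH : ∀ φ, 0 ≤ φ ⬝ᵥ (WE *ᵥ (H *ᵥ φ)))
    (hK : ∀ u, u ≠ 0 → 0 < u ⬝ᵥ (WK *ᵥ u))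
    (hadj : ∀ φ ψ, φ ⬝ᵥ (WE *ᵥ (Xs *ᵥ ψ)) = (X *ᵥ φ) ⬝ᵥ (WK *ᵥ ψ))
    {φ : ι → ℝ} (h0 : (H + c • (Xs * X)) *ᵥ φ = 0) : H *ᵥ φ = 0 ∧ X *ᵥ φ = 0 := by
  have hexp : (H + c • (Xs * X)) *ᵥ φ = H *ᵥ φ + c • (Xs *ᵥ (X *ᵥ φ)) := by
    rw [Matrix.add_mulVec, Matrix.smul_mulVec, ← Matrix.mulVec_mulVec]
  have hX : X *ᵥ φ = 0 := by
    by_contra hne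
    have hpos := hK _ hne
    have hform : φ ⬝ᵥ (WE *ᵥ ((H + c • (Xs * X)) *ᵥ φ))
        = φ ⬝ᵥ (WE *ᵥ (H *ᵥ φ)) + c * ((X *ᵥ φ) ⬝ᵥ (WK *ᵥ (X *ᵥ φ))) := by
      rw [hexp, Matrix.mulVec_add, dotProduct_add, Matrix.mulVec_smul, dotProduct_smul, hadj, smul_eq_mul]
    rw [h0, Matrix.mulVec_zero, dotProduct_zero] at hform
    have h1 := hH φ
    have h2 := mul_pos hc hpos
    linarith
  refine ⟨?_, hX⟩
  have h2 := hexp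
  rw [h0, hX, Matrix.mulVec_zero, smul_zero, add_zero] at h2
  exact h2.symm

omit [Fintype ν] [DecidableEq κ] [DecidableEq ν] in
/-- If H is positive DEFINITE for W_E (e.g. m² > 0 in −Δ^{ε,N}_{A,Ω} + m²) then H + c·X^*X is invertible for every
c > 0. [folklore] -/
theorem isUnit_of_posDef {H : Matrix ι ι ℝ} {X : Matrix κ ι ℝ} {Xs : Matrix ι κ ℝ} {WE : Matrix ι ι ℝ}
    {WK : Matrix κ κ ℝ} {c : ℝ} (hc : 0 < c) (hH : ∀ φ, φ ≠ 0 → 0 < φ ⬝ᵥ (WE *ᵥ (H *ᵥ φ)))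
    (hK : ∀ u, u ≠ 0 → 0 < u ⬝ᵥ (WK *ᵥ u))
    (hadj : ∀ φ ψ, φ ⬝ᵥ (WE *ᵥ (Xs *ᵥ ψ)) = (X *ᵥ φ) ⬝ᵥ (WK *ᵥ ψ)) : IsUnit (H + c • (Xs * X)) := by
  have hH' : ∀ φ, 0 ≤ φ ⬝ᵥ (WE *ᵥ (H *ᵥ φ)) := fun φ => by
    by_cases h : φ = 0
    · rw [h, Matrix.mulVec_zero, Matrix.mulVec_zero, dotProduct_zero]
    · exact (hH φ h).le
  rw [← Matrix.mulVec_injective_iff_isUnit]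
  refine mulVec_injective_of_ker fun φ h0 => ?_
  obtain ⟨hHφ, -⟩ := ker_add_smul_adj hc hH' hK hadj h0
  by_contra hne
  have h1 := hH φ hne
  rw [hHφ, Matrix.mulVec_zero, dotProduct_zero] at h1
  exact lt_irrefl _ h1

namespace StepData

variable (S : StepData ℝ ι κ ν)

/-- The Euclidean structure of B1 (1.5) for one step, as HYPOTHESES on the data: positive definite scalar products
⟨u,v⟩ = u ⬝ᵥ (W *ᵥ v) on the three lattices (weights ε^d, (L^kε)^d, (L^{k+1}ε)^d in print), Q^*_k and Q^* the adjoints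
of Q_k and Q ("The adjoint operators with respect to the scalar product (1.5) can be easily written up", p. 604),
−Δ^{ε,N}_{A,Ω} + m² positive semi-definite, and a_k, a > 0 (so α, β > 0).
[cite: Balaban1982Higgs1, (1.5) p.604, (2.17)/(2.20) p.610] -/
structure ScalarProducts (WE : Matrix ι ι ℝ) (WK : Matrix κ κ ℝ) (WM : Matrix ν ν ℝ) : Prop where
  /-- ⟨u,u⟩_{L^kε} > 0 for u ≠ 0 -/
  posK : ∀ u, u ≠ 0 → 0 < u ⬝ᵥ (WK *ᵥ u)
  /-- ⟨v,v⟩_{L^{k+1}ε} > 0 for v ≠ 0 -/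
  posM : ∀ v, v ≠ 0 → 0 < v ⬝ᵥ (WM *ᵥ v)
  /-- ⟨φ, (−Δ^{ε,N}_{A,Ω} + m²)φ⟩_ε ≥ 0 -/
  formH : ∀ φ, 0 ≤ φ ⬝ᵥ (WE *ᵥ (S.H *ᵥ φ))
  /-- Q^*_k(A) is the adjoint of Q_k(A) for (⟨·,·⟩_ε, ⟨·,·⟩_{L^kε}) (B1 p. 604) -/
  adjk : ∀ φ ψ, φ ⬝ᵥ (WE *ᵥ (S.Qks *ᵥ ψ)) = (S.Qk *ᵥ φ) ⬝ᵥ (WK *ᵥ ψ)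
  /-- Q^*(A) is the adjoint of Q(A) for (⟨·,·⟩_{L^kε}, ⟨·,·⟩_{L^{k+1}ε}) -/
  adj : ∀ ψ θ, ψ ⬝ᵥ (WK *ᵥ (S.Qs *ᵥ θ)) = (S.Q *ᵥ ψ) ⬝ᵥ (WM *ᵥ θ)
  /-- a_k(L^kε)^{−2} > 0 (a_k > 0, (2.15)) -/
  α_pos : 0 < S.α
  /-- a(L^{k+1}ε)^{−2} > 0 -/
  β_pos : 0 < S.β

variable {S} {WE : Matrix ι ι ℝ} {WK : Matrix κ κ ℝ} {WM : Matrix ν ν ℝ}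

omit [DecidableEq ι] [DecidableEq κ] [DecidableEq ν] in
/-- ⟨u,u⟩_{L^kε} ≥ 0. [folklore] -/
theorem ScalarProducts.posK_nonneg (E : S.ScalarProducts WE WK WM) (u : κ → ℝ) : 0 ≤ u ⬝ᵥ (WK *ᵥ u) := by
  by_cases h : u = 0
  · rw [h, Matrix.mulVec_zero, dotProduct_zero]
  · exact (E.posK u h).le

omit [DecidableEq ι] [DecidableEq κ] [DecidableEq ν] in
/-- ⟨v,v⟩_{L^{k+1}ε} ≥ 0. [folklore] -/
theorem ScalarProducts.posM_nonneg (E : S.ScalarProducts WE WK WM) (v : ν → ℝ) : 0 ≤ v ⬝ᵥ (WM *ᵥ v) := by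
  by_cases h : v = 0
  · rw [h, Matrix.mulVec_zero, dotProduct_zero]
  · exact (E.posM v h).le

omit [DecidableEq ι] [DecidableEq κ] [DecidableEq ν] in
/-- α + β = a_k(L^kε)^{−2} + a(L^{k+1}ε)^{−2} ≠ 0 (a_k, a > 0). [cite: Balaban1982Higgs1, (2.15) p.609] -/
theorem ScalarProducts.αβ_ne (E : S.ScalarProducts WE WK WM) : S.α + S.β ≠ 0 := (add_pos E.α_pos E.β_pos).ne'

omit [DecidableEq κ] [DecidableEq ν] in
/-- Invertibility propagates DOWN one step, I: if −Δ^{ε,N}_{A,Ω} + m² + a_{k+1}(L^{k+1}ε)^{−2}P_{k+1} is invertible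
then so is −Δ^{ε,N}_{A,Ω} + m² + a_k(L^kε)^{−2}P_k (ker(H + αP_k) ⊂ ker H ∩ ker Q_k ⊂ ker(H + γP_{k+1})). [folklore] -/
theorem isUnit_prev_of_next (E : S.ScalarProducts WE WK WM) (hnext : IsUnit (S.H + S.γ • S.Pk1)) :
    IsUnit (S.H + S.α • S.Pk) := by
  have hinj := Matrix.mulVec_injective_iff_isUnit.mpr hnext
  rw [← Matrix.mulVec_injective_iff_isUnit]
  refine mulVec_injective_of_ker fun φ h0 => ?_
  obtain ⟨hHφ, hQφ⟩ := ker_add_smul_adj (X := S.Qk) (Xs := S.Qks) E.α_pos E.formH E.posK E.adjk h0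
  apply hinj
  show (S.H + S.γ • S.Pk1) *ᵥ φ = (S.H + S.γ • S.Pk1) *ᵥ 0
  rw [Matrix.mulVec_zero, Matrix.add_mulVec, Matrix.smul_mulVec, hHφ, zero_add,
    show S.Pk1 = S.Qks * S.Qs * S.Q * S.Qk by simp only [Pk1, Qk1, Qk1s, Matrix.mul_assoc],
    ← Matrix.mulVec_mulVec, hQφ, Matrix.mulVec_zero, smul_zero]

omit [DecidableEq ν] in
/-- Invertibility propagates DOWN one step, II — the finite-lattice content of "It is not clear from the formulas
(2.30), (2.31) that the covariances are well defined. It is so" (B1 p. 611): if −Δ^{ε,N}_{A,Ω} + m² +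
a_{k+1}(L^{k+1}ε)^{−2}P_{k+1} is invertible then a(L^{k+1}ε)^{−2}P + Δ^{(k),L^kε} is invertible.  (Proof: for ψ in the
kernel put w := αG_kQ^*_kψ, u := ψ − Q_kw; then ⟨w,Hw⟩ + α⟨u,u⟩ + β⟨Qψ,Qψ⟩ = 0, so u = 0, Qψ = 0, whence
(H + γP_{k+1})w = 0, w = 0, ψ = Q_kw = 0.) [cite: Balaban1982Higgs1, (2.30)–(2.31) p.611] -/
theorem isUnit_C_of_next (E : S.ScalarProducts WE WK WM) (hnext : IsUnit (S.H + S.γ • S.Pk1)) :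
    IsUnit (S.β • S.P + S.Δk) := by
  have hGmul := S.Gk_mul (isUnit_prev_of_next E hnext)
  have hinj := Matrix.mulVec_injective_iff_isUnit.mpr hnext
  rw [← Matrix.mulVec_injective_iff_isUnit]
  refine mulVec_injective_of_ker fun ψ hD0 => ?_
  -- the test vector w = αG_kQ^*_kψ and u = ψ − Q_kw
  obtain ⟨w, hw⟩ : ∃ w : ι → ℝ, w = S.α • (S.Gk *ᵥ (S.Qks *ᵥ ψ)) := ⟨_, rfl⟩
  obtain ⟨u, hu⟩ : ∃ u : κ → ℝ, u = ψ - S.Qk *ᵥ w := ⟨_, rfl⟩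
  have hAw : (S.H + S.α • S.Pk) *ᵥ w = S.α • (S.Qks *ᵥ ψ) := by
    rw [hw, Matrix.mulVec_smul, Matrix.mulVec_mulVec (S.Qks *ᵥ ψ) (S.H + S.α • S.Pk) S.Gk, hGmul,
      Matrix.one_mulVec]
  have hHw : S.H *ᵥ w = S.α • (S.Qks *ᵥ u) := by
    have h1 := hAw
    rw [Matrix.add_mulVec, Matrix.smul_mulVec, show S.Pk *ᵥ w = S.Qks *ᵥ (S.Qk *ᵥ w) from
      (Matrix.mulVec_mulVec _ _ _).symm] at h1
    rw [hu, Matrix.mulVec_sub, smul_sub, ← h1]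
    abel
  have hDexp : (S.β • S.P + S.Δk) *ᵥ ψ = S.β • (S.Qs *ᵥ (S.Q *ᵥ ψ)) + S.α • u := by
    rw [hu, smul_sub, hw, Matrix.mulVec_smul, smul_smul, ← pow_two]
    simp only [Δk, P, Matrix.add_mulVec, Matrix.sub_mulVec, Matrix.smul_mulVec, Matrix.one_mulVec,
      ← Matrix.mulVec_mulVec]
  have hαu : S.α • u = -(S.β • (S.Qs *ᵥ (S.Q *ᵥ ψ))) := by
    have h1 := hDexp
    rw [hD0] at h1
    exact eq_neg_of_add_eq_zero_right h1.symm
  -- the form identity ⟨w,Hw⟩ + α⟨u,u⟩ + β⟨Qψ,Qψ⟩ = 0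
  have e1 : w ⬝ᵥ (WE *ᵥ (S.H *ᵥ w)) = S.α * ((S.Qk *ᵥ w) ⬝ᵥ (WK *ᵥ u)) := by
    rw [hHw, Matrix.mulVec_smul, dotProduct_smul, E.adjk, smul_eq_mul]
  have e2 : S.Qk *ᵥ w = ψ - u := by rw [hu]; abel
  have e3 : S.α * (ψ ⬝ᵥ (WK *ᵥ u)) = -(S.β * ((S.Q *ᵥ ψ) ⬝ᵥ (WM *ᵥ (S.Q *ᵥ ψ)))) := by
    have h1 : ψ ⬝ᵥ (WK *ᵥ (S.α • u)) = S.α * (ψ ⬝ᵥ (WK *ᵥ u)) := by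
      rw [Matrix.mulVec_smul, dotProduct_smul, smul_eq_mul]
    rw [← h1, hαu, Matrix.mulVec_neg, dotProduct_neg, Matrix.mulVec_smul, dotProduct_smul, E.adj, smul_eq_mul]
  have hform : w ⬝ᵥ (WE *ᵥ (S.H *ᵥ w)) + S.α * (u ⬝ᵥ (WK *ᵥ u))
      + S.β * ((S.Q *ᵥ ψ) ⬝ᵥ (WM *ᵥ (S.Q *ᵥ ψ))) = 0 := by
    rw [e1, e2, sub_dotProduct]
    linear_combination e3
  -- consequences: u = 0 and Qψ = 0
  have hHw0 : 0 ≤ w ⬝ᵥ (WE *ᵥ (S.H *ᵥ w)) := E.formH w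
  have hA : 0 ≤ S.α * (u ⬝ᵥ (WK *ᵥ u)) := mul_nonneg E.α_pos.le (E.posK_nonneg u)
  have hB : 0 ≤ S.β * ((S.Q *ᵥ ψ) ⬝ᵥ (WM *ᵥ (S.Q *ᵥ ψ))) := mul_nonneg E.β_pos.le (E.posM_nonneg _)
  have hu0 : u = 0 := by
    by_contra hne
    have h1 := mul_pos E.α_pos (E.posK u hne)
    linarith
  have hQψ : S.Q *ᵥ ψ = 0 := by
    by_contra hne
    have h1 := mul_pos E.β_pos (E.posM _ hne)
    linarith
  -- hence Hw = 0, ψ = Q_kw, (H + γP_{k+1})w = 0, w = 0, ψ = 0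
  have hHw' : S.H *ᵥ w = 0 := by rw [hHw, hu0, Matrix.mulVec_zero, smul_zero]
  have hψw : ψ = S.Qk *ᵥ w := by
    have h1 : ψ - S.Qk *ᵥ w = 0 := by rw [← hu]; exact hu0
    exact sub_eq_zero.mp h1
  have hw0 : w = 0 := by
    apply hinj
    show (S.H + S.γ • S.Pk1) *ᵥ w = (S.H + S.γ • S.Pk1) *ᵥ 0
    rw [Matrix.mulVec_zero, Matrix.add_mulVec, Matrix.smul_mulVec, hHw', zero_add,
      show S.Pk1 = S.Qk1s * (S.Q * S.Qk) from rfl, ← Matrix.mulVec_mulVec, ← Matrix.mulVec_mulVec, ← hψw, hQψ,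
      Matrix.mulVec_zero, smul_zero]
  rw [hψw, hw0, Matrix.mulVec_zero]

/-- (2.42) with the printed EXISTENCE hypotheses only: given the Euclidean structure (1.5), QQ^* = 1 and the
invertibility of the argument of G^ε_{k+1} (e.g. from m² > 0, `isUnit_of_posDef`), the arguments of G^ε_k and
C^{(k),L^kε} are invertible and (2.42) holds. [cite: Balaban1982Higgs1, (2.42) p.612] -/
theorem display242_of_next (E : S.ScalarProducts WE WK WM) (hQ : S.Q * S.Qs = 1)
    (hnext : IsUnit (S.H + S.γ • S.Pk1)) :
    S.Gk1 = S.α ^ 2 • (S.Gk * S.Qks * S.Ck * S.Qk * S.Gk) + S.Gk :=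
  S.display242 hQ E.αβ_ne (isUnit_prev_of_next E hnext) (isUnit_C_of_next E hnext)

/-- (2.41) with the printed EXISTENCE hypotheses only (as `display242_of_next`). [cite: Balaban1982Higgs1, (2.41) p.612] -/
theorem display241_of_next (E : S.ScalarProducts WE WK WM) (hQ : S.Q * S.Qs = 1)
    (hnext : IsUnit (S.H + S.γ • S.Pk1)) :
    S.Qk1 * S.Gk1 = (S.α + S.β) • (S.Q * S.Ck * S.Qk * S.Gk) :=
  S.display241 hQ E.αβ_ne (isUnit_prev_of_next E hnext) (isUnit_C_of_next E hnext)

/-- With m² > 0 (H positive DEFINITE for W_ε) nothing needs to be assumed: G^ε_k, C^{(k),L^kε}, G^ε_{k+1} all exist and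
(2.41)/(2.42) hold. [cite: Balaban1982Higgs1, (2.17)/(2.20) p.610, (2.41)–(2.42) p.612] -/
theorem display242_of_posDef (E : S.ScalarProducts WE WK WM) (hQ : S.Q * S.Qs = 1)
    (hH : ∀ φ, φ ≠ 0 → 0 < φ ⬝ᵥ (WE *ᵥ (S.H *ᵥ φ))) :
    IsUnit (S.H + S.γ • S.Pk1) ∧ S.Gk1 = S.α ^ 2 • (S.Gk * S.Qks * S.Ck * S.Qk * S.Gk) + S.Gk
      ∧ S.Qk1 * S.Gk1 = (S.α + S.β) • (S.Q * S.Ck * S.Qk * S.Gk) := by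
  -- Q^*_{k+1} = Q^*_kQ^* is the adjoint of Q_{k+1} = QQ_k for (W_ε, W_{k+1}); γ > 0
  have hγ : 0 < S.γ := div_pos (mul_pos E.α_pos E.β_pos) (add_pos E.α_pos E.β_pos)
  have hadj1 : ∀ φ θ, φ ⬝ᵥ (WE *ᵥ (S.Qk1s *ᵥ θ)) = (S.Qk1 *ᵥ φ) ⬝ᵥ (WM *ᵥ θ) := fun φ θ => by
    rw [Qk1s, Qk1, ← Matrix.mulVec_mulVec, E.adjk, E.adj, Matrix.mulVec_mulVec]
  have hnext : IsUnit (S.H + S.γ • S.Pk1) := isUnit_of_posDef (X := S.Qk1) (Xs := S.Qk1s) hγ hH E.posM hadj1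
  exact ⟨hnext, display242_of_next E hQ hnext, display241_of_next E hQ hnext⟩

end StepData

end Positivity

/-! ## §D  The printed coefficients: a_k, a, a_{k+1} and (2.13) -/

section Scalars

/-- The scalar dictionary of (2.41)/(2.42): with α = a_k(L^kε)^{−2}, β = a(L^{k+1}ε)^{−2} and (2.13)
a_{k+1} = aa_k/(aL^{−2} + a_k):  αβ/(α + β) = a_{k+1}(L^{k+1}ε)^{−2},  α + β = (aa_k/a_{k+1})(L^kε)^{−2},
α² = a_k²(L^kε)^{−4}  (ℓ := L^kε > 0). [cite: Balaban1982Higgs1, (2.13) p.609, (2.41)–(2.42) p.612] -/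
theorem scalars_213 {a ak L ℓ : ℝ} (ha : 0 < a) (hak : 0 < ak) (hL : 0 < L) (hℓ : 0 < ℓ) :
    (ak * (ℓ ^ 2)⁻¹) * (a * ((L * ℓ) ^ 2)⁻¹) / (ak * (ℓ ^ 2)⁻¹ + a * ((L * ℓ) ^ 2)⁻¹)
        = (a * ak / (a * (L ^ 2)⁻¹ + ak)) * ((L * ℓ) ^ 2)⁻¹
      ∧ ak * (ℓ ^ 2)⁻¹ + a * ((L * ℓ) ^ 2)⁻¹ = (a * ak / (a * ak / (a * (L ^ 2)⁻¹ + ak))) * (ℓ ^ 2)⁻¹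
      ∧ (ak * (ℓ ^ 2)⁻¹) ^ 2 = ak ^ 2 * (ℓ ^ 4)⁻¹ := by
  have hL2 : 0 < a * (L ^ 2)⁻¹ + ak := by positivity
  refine ⟨?_, ?_, ?_⟩
  all_goals first | (field_simp; ring) | field_simp

namespace StepData

variable {ι κ ν : Type*} [Fintype ι] [Fintype κ] [Fintype ν] [DecidableEq ι] [DecidableEq κ] [DecidableEq ν]
variable (S : StepData ℝ ι κ ν)

omit [Fintype ι] [Fintype κ] [Fintype ν] [DecidableEq ι] [DecidableEq κ] [DecidableEq ν] in
/-- γ = a_{k+1}(L^{k+1}ε)^{−2} with a_{k+1} the tree's `B1.aSeq a L (k+1)` (its recursion `B1.aSeq_succ` IS (2.13)),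
when α = a_k(L^kε)^{−2}, β = a(L^{k+1}ε)^{−2}. [cite: Balaban1982Higgs1, (2.13)/(2.15) p.609] -/
theorem γ_printed {a L ℓ : ℝ} {k : ℕ} (ha : 0 < a) (hL : 1 < L) (hk : 1 ≤ k) (hℓ : 0 < ℓ)
    (hα : S.α = B1.aSeq a L k * (ℓ ^ 2)⁻¹) (hβ : S.β = a * ((L * ℓ) ^ 2)⁻¹) :
    S.γ = B1.aSeq a L (k + 1) * ((L * ℓ) ^ 2)⁻¹ := by
  have hak := B1.aSeq_pos ha hL hk
  rw [γ, hα, hβ, (scalars_213 ha hak (lt_trans one_pos hL) hℓ).1, B1.aSeq_succ ha hL hk]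

/-- (2.42) with the printed coefficient a_k²(L^kε)^{−4}. [cite: Balaban1982Higgs1, (2.42) p.612] -/
theorem display242_printed {a L ℓ : ℝ} {k : ℕ} (hQ : S.Q * S.Qs = 1) (hαβ : S.α + S.β ≠ 0)
    (hG : IsUnit (S.H + S.α • S.Pk)) (hC : IsUnit (S.β • S.P + S.Δk))
    (hα : S.α = B1.aSeq a L k * (ℓ ^ 2)⁻¹) :
    S.Gk1 = (B1.aSeq a L k ^ 2 * (ℓ ^ 4)⁻¹) • (S.Gk * S.Qks * S.Ck * S.Qk * S.Gk) + S.Gk := by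
  rw [S.display242 hQ hαβ hG hC, hα]
  congr 1
  congr 1
  ring

/-- (2.41) with the printed coefficient (aa_k/a_{k+1})(L^kε)^{−2}. [cite: Balaban1982Higgs1, (2.41) p.612] -/
theorem display241_printed {a L ℓ : ℝ} {k : ℕ} (ha : 0 < a) (hL : 1 < L) (hk : 1 ≤ k) (hℓ : 0 < ℓ)
    (hQ : S.Q * S.Qs = 1) (hG : IsUnit (S.H + S.α • S.Pk)) (hC : IsUnit (S.β • S.P + S.Δk))
    (hα : S.α = B1.aSeq a L k * (ℓ ^ 2)⁻¹) (hβ : S.β = a * ((L * ℓ) ^ 2)⁻¹) :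
    S.Qk1 * S.Gk1 = (a * B1.aSeq a L k / B1.aSeq a L (k + 1) * (ℓ ^ 2)⁻¹) • (S.Q * S.Ck * S.Qk * S.Gk) := by
  have hak := B1.aSeq_pos ha hL hk
  have hL0 : 0 < L := lt_trans one_pos hL
  have hαβ : S.α + S.β ≠ 0 := by
    rw [hα, hβ]
    exact (add_pos (mul_pos hak (by positivity)) (mul_pos ha (by positivity))).ne'
  rw [S.display241 hQ hαβ hG hC, hα, hβ, (scalars_213 ha hak (lt_trans one_pos hL) hℓ).2.1,
    B1.aSeq_succ ha hL hk]

end StepData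

end Scalars

/-! ## §E  The tower and (2.43) = B4 (2.34) -/

/-- A TOWER of renormalization steps j = 0, 1, 2, … sharing H = −Δ^{ε,N}_{A,Ω} + m² (level-0 data is never used:
(2.43) starts at j = 1): `κ j` = the sites of Ω^{(j)}, `Qk j`, `Qks j` ↤ Q_j(A), Q^*_j(A); `Q j`, `Qs j` ↤ Q(A), Q^*(A)
on the L^jε-lattice; `α j` ↤ a_j(L^jε)^{−2}; `β j` ↤ a(L^{j+1}ε)^{−2}.  Universe-monomorphic (`Type`) so that the
tree's telescoping lemma `B1.display243_of_242 {R : Type}` applies with R := Matrix ι ι 𝕜.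
[cite: Balaban1982Higgs1, (2.11) p.609, (2.20) p.610, (2.43) p.612] -/
structure Tower (𝕜 : Type) (ι : Type) where
  /-- the sites of Ω^{(j)} ⊂ T^{(j)}_{L^jε} -/
  κ : ℕ → Type
  /-- Ω^{(j)} is a finite set -/
  instFintype : ∀ j, Fintype (κ j)
  /-- with decidable equality (Kronecker deltas / identity matrices) -/
  instDecEq : ∀ j, DecidableEq (κ j)
  /-- −Δ^{ε,N}_{A,Ω} + m² (2.17) -/
  H : Matrix ι ι 𝕜
  /-- Q_j(A) (2.11) -/
  Qk : ∀ j, Matrix (κ j) ι 𝕜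
  /-- Q^*_j(A) -/
  Qks : ∀ j, Matrix ι (κ j) 𝕜
  /-- Q(A) on the L^jε-lattice (2.7) -/
  Q : ∀ j, Matrix (κ (j + 1)) (κ j) 𝕜
  /-- Q^*(A) on the L^jε-lattice -/
  Qs : ∀ j, Matrix (κ j) (κ (j + 1)) 𝕜
  /-- a_j(L^jε)^{−2} -/
  α : ℕ → 𝕜
  /-- a(L^{j+1}ε)^{−2} -/
  β : ℕ → 𝕜

/-- The carried `Fintype` structure of level j (B1 p. 608: T^{(k)}_1 ⊂ T_η is finite). [folklore] -/
instance Tower.fintypeκ {𝕜 ι : Type} (T : Tower 𝕜 ι) (j : ℕ) : Fintype (T.κ j) := T.instFintype j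

/-- The carried decidable equality of level j. [folklore] -/
instance Tower.decEqκ {𝕜 ι : Type} (T : Tower 𝕜 ι) (j : ℕ) : DecidableEq (T.κ j) := T.instDecEq j

namespace Tower

variable {𝕜 : Type} [Field 𝕜] {ι : Type} [Fintype ι] [DecidableEq ι] (T : Tower 𝕜 ι)

/-- Level j of the tower as one-step data (§B). [cite: Balaban1982Higgs1, (2.11) p.609, (2.20) p.610] -/
def step (j : ℕ) : StepData 𝕜 ι (T.κ j) (T.κ (j + 1)) :=
  ⟨T.H, T.Qk j, T.Qks j, T.Q j, T.Qs j, T.α j, T.β j⟩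

/-- G^ε_j(Ω,A) = (H + α_jP_j)^{−1} (2.20). [cite: Balaban1982Higgs1, (2.20) p.610] -/
noncomputable def G (j : ℕ) : Matrix ι ι 𝕜 := (T.step j).Gk

/-- C^{(j),L^jε}(Ω,A) (2.30). [cite: Balaban1982Higgs1, (2.30) p.611] -/
noncomputable def C (j : ℕ) : Matrix (T.κ j) (T.κ j) 𝕜 := (T.step j).Ck

/-- The j-th term a_j²(L^jε)^{−4}G^ε_jQ^*_jC^{(j),L^jε}Q_jG^ε_j of (2.43). [cite: Balaban1982Higgs1, (2.43) p.612] -/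
noncomputable def term (j : ℕ) : Matrix ι ι 𝕜 := T.α j ^ 2 • (T.G j * T.Qks j * T.C j * T.Qk j * T.G j)

/-- The tower relations, all as HYPOTHESES for the levels j ≥ 1: QQ^* = 1; Q_{j+1} = QQ_j, Q^*_{j+1} = Q^*_jQ^*
((2.2)/(2.11)); α_{j+1} = α_jβ_j/(α_j + β_j) ((2.13) in the form of §D); α_j + β_j ≠ 0; and the invertibility of the
arguments of G^ε_j (2.20) and C^{(j),L^jε} (2.30) (from §C when m² > 0, or B1 Prop. 2.3).
[cite: Balaban1982Higgs1, (2.11)–(2.14) p.609, (2.20) p.610, (2.30) p.611] -/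
structure Consistent : Prop where
  /-- Q^{(j)}Q^{(j)*} = 1 (B4 p. 580 "orthogonal projection") -/
  QQs : ∀ j, 1 ≤ j → T.Q j * T.Qs j = 1
  /-- Q_{j+1}(A) = Q(A)Q_j(A) (contour concatenation (2.2), operator content of (2.12)/(2.14)) -/
  Qk_succ : ∀ j, 1 ≤ j → T.Qk (j + 1) = T.Q j * T.Qk j
  /-- Q^*_{j+1}(A) = Q^*_j(A)Q^*(A) -/
  Qks_succ : ∀ j, 1 ≤ j → T.Qks (j + 1) = T.Qks j * T.Qs j
  /-- a_{j+1}(L^{j+1}ε)^{−2} = α_jβ_j/(α_j + β_j), i.e. (2.13) (§D `γ_printed`) -/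
  α_succ : ∀ j, 1 ≤ j → T.α (j + 1) = T.α j * T.β j / (T.α j + T.β j)
  /-- α_j + β_j ≠ 0 -/
  αβ_ne : ∀ j, 1 ≤ j → T.α j + T.β j ≠ 0
  /-- G^ε_j is a genuine inverse: −Δ^{ε,N}_{A,Ω} + m² + a_j(L^jε)^{−2}P_j(A) invertible -/
  G_arg : ∀ j, 1 ≤ j → IsUnit (T.H + T.α j • (T.Qks j * T.Qk j))
  /-- C^{(j),L^jε} is a genuine inverse: a(L^{j+1}ε)^{−2}P(A) + Δ^{(j),L^jε} invertible ("It is so", p. 611) -/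
  C_arg : ∀ j, 1 ≤ j → IsUnit ((T.step j).β • (T.step j).P + (T.step j).Δk)

/-- (2.42) along the tower: G_{j+1} = term_j + G_j for j ≥ 1. [cite: Balaban1982Higgs1, (2.42) p.612] -/
theorem G_succ (h : T.Consistent) (j : ℕ) (hj : 1 ≤ j) : T.G (j + 1) = T.term j + T.G j := by
  have e : T.G (j + 1) = (T.step j).Gk1 := by
    show (T.step (j + 1)).Gk = (T.step j).Gk1
    simp only [StepData.Gk, StepData.Gk1, StepData.Pk, StepData.Pk1, StepData.Qk1, StepData.Qk1s, StepData.γ,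
      step, h.Qk_succ j hj, h.Qks_succ j hj, h.α_succ j hj]
  rw [e, StepData.display242 _ (h.QQs j hj) (h.αβ_ne j hj) (h.G_arg j hj) (h.C_arg j hj)]
  rfl

/-- B1 (2.43) = B4 (2.34) ("(2.43) of [1] rescaled to the η-lattice"; on ANY finite carrier, in particular "with □
replaced by the whole torus", B5 p. 39), KERNEL-PROVED from (2.42) by the tree's telescoping lemma
`B1.display243_of_242`:  G^ε_k = Σ_{j=1}^{k−1} a_j²(L^jε)^{−4}G^ε_jQ^*_jC^{(j),L^jε}Q_jG^ε_j + G^ε_1  (k ≥ 1), where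
G^ε_1 = (a(Lε)^{−2}P(A) + Δ^{(0),ε})^{−1} = C^{(0),ε} by (2.17)/(2.30) (a_1 = a, Q_1 = Q).
[cite: Balaban1982Higgs1, (2.43) p.612; Balaban1983RegularityDecay, (2.34) p.582; Balaban1984PropagatorsI, (1.135) p.39] -/
theorem display243 (h : T.Consistent) (k : ℕ) (hk : 1 ≤ k) :
    T.G k = (∑ j ∈ Finset.Ico 1 k, T.term j) + T.G 1 :=
  B1.display243_of_242 T.G T.term (T.G 1) rfl (fun j hj => T.G_succ h j hj) k hk

/-! ### The tower over ℝ: (2.43) from the structural hypotheses and m² > 0 alone -/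

/-- Over ℝ, the invertibility fields `G_arg`, `C_arg` of `Consistent` FOLLOW from the structural ones (QQ^* = 1,
Q_{j+1} = QQ_j, Q^*_{j+1} = Q^*_jQ^*, (2.13)) together with adjointness/positivity of the scalar products (1.5)
at every level (`ScalarProducts` for each step, weights `WE` on Ω ⊂ T_ε and `W j` on Ω^{(j)}) and −Δ^{ε,N}_{A,Ω} + m²
positive definite (m² > 0): the finite-lattice content of B1 p. 611 "It is so" at every level j ≥ 1.
[cite: Balaban1982Higgs1, (2.30)–(2.31) p.611, (2.20) p.610] -/
theorem consistent_of_posDef (T : Tower ℝ ι) (WE : Matrix ι ι ℝ) (W : ∀ j, Matrix (T.κ j) (T.κ j) ℝ)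
    (hQ : ∀ j, 1 ≤ j → T.Q j * T.Qs j = 1) (hQk : ∀ j, 1 ≤ j → T.Qk (j + 1) = T.Q j * T.Qk j)
    (hQks : ∀ j, 1 ≤ j → T.Qks (j + 1) = T.Qks j * T.Qs j)
    (hα : ∀ j, 1 ≤ j → T.α (j + 1) = T.α j * T.β j / (T.α j + T.β j))
    (E : ∀ j, 1 ≤ j → (T.step j).ScalarProducts WE (W j) (W (j + 1)))
    (hH : ∀ φ, φ ≠ 0 → 0 < φ ⬝ᵥ (WE *ᵥ (T.H *ᵥ φ))) : T.Consistent where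
  QQs := hQ
  Qk_succ := hQk
  Qks_succ := hQks
  α_succ := hα
  αβ_ne j hj := (E j hj).αβ_ne
  G_arg j hj := isUnit_of_posDef (X := T.Qk j) (Xs := T.Qks j) (E j hj).α_pos hH (E j hj).posK (E j hj).adjk
  C_arg j hj := StepData.isUnit_C_of_next (E j hj) (StepData.display242_of_posDef (E j hj) (hQ j hj) hH).1

/-- (2.43) = B4 (2.34) over ℝ from the structural hypotheses, the scalar products (1.5) and m² > 0 alone.
[cite: Balaban1982Higgs1, (2.43) p.612; Balaban1983RegularityDecay, (2.34) p.582] -/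
theorem display243_of_posDef (T : Tower ℝ ι) (WE : Matrix ι ι ℝ) (W : ∀ j, Matrix (T.κ j) (T.κ j) ℝ)
    (hQ : ∀ j, 1 ≤ j → T.Q j * T.Qs j = 1) (hQk : ∀ j, 1 ≤ j → T.Qk (j + 1) = T.Q j * T.Qk j)
    (hQks : ∀ j, 1 ≤ j → T.Qks (j + 1) = T.Qks j * T.Qs j)
    (hα : ∀ j, 1 ≤ j → T.α (j + 1) = T.α j * T.β j / (T.α j + T.β j))
    (E : ∀ j, 1 ≤ j → (T.step j).ScalarProducts WE (W j) (W (j + 1)))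
    (hH : ∀ φ, φ ≠ 0 → 0 < φ ⬝ᵥ (WE *ᵥ (T.H *ᵥ φ))) (k : ℕ) (hk : 1 ≤ k) :
    T.G k = (∑ j ∈ Finset.Ico 1 k, T.term j) + T.G 1 :=
  T.display243 (T.consistent_of_posDef WE W hQ hQk hQks hα E hH) k hk

end Tower

end Literature.MathematicalPhysics.QuantumFieldTheory.Balaban1983to89.B1RG242
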